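import Literature.NumberTheory.Transcendental.KaehlerHodgeSymmAssemblyProofs
import Literature.NumberTheory.Transcendental.KaehlerIdentityLaplacianCorollaries
import Literature.AlgebraicGeometry.Motives.HodgeDecompositionIsInternalDischarge
import HarnessLib

/-!
# Hodge symmetry `h^{p,q} = h^{q,p}` holds (discharge of `hodgeNumber_symm_of_isKaehlerManifold`)

Trunk **T-KAEHLER** (`NumberTheory/Transcendental`). Theorems-only leaf companion of
`KaehlerHodge.lean` (the named fact
`Literature.NumberTheory.Transcendental.hodgeNumber_symm_of_isKaehlerManifold`: on a compact complex
manifold admitting a smooth Kähler metric, `h^{p,q} = h^{q,p}` for the Dolbeault Hodge numbers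
`hodgeNumber E M p q = dim_ℂ H^{p,q}_∂̄(M)`; C. Voisin, *Hodge Theory and Complex Algebraic Geometry I*
(2002), §6.1.3 Cor. 6.12 (with §6.1.2 Thm. 6.7, Cor. 6.10 and §5.3.2 Thm. 5.24); D. Huybrechts,
*Complex Geometry* (2005), Cor. 3.2.12; P. Griffiths, J. Harris, *Principles of Algebraic Geometry*
(1978), p. 116) and of its assembly file `KaehlerHodgeSymmAssemblyProofs.lean`, whose
`hodgeNumber_symm_of_isKaehlerManifold_of_regularity_of_compactness_of_kaehlerIdentity` reduces the
fact to three inputs quantified over every smooth metric `g` and orientation family `o`: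

* `hC` / `hR` — Warner's Theorems 6.6 / 6.5 for `Δ_∂̄` on the Hermitian inner product spaces
  `A^{p,q}(M)` (`CL2SmoothForms.pq o p q`): THEOREMS of the tree's periodic-elliptic programme,
  `CL2SmoothForms.pq_compact` (`TorusDolbeaultCompactAll`) and `CL2SmoothForms.pq_regular`
  (`TorusDolbeaultRegularityPq`), exactly as they are fed to the Hodge decomposition in
  `Literature.AlgebraicGeometry.Motives.HodgeDecompositionIsInternalDischarge`;
* `hK` — the Kähler identity `Δ_∂̄ = Δ_∂` on smooth forms (the corrected named fact
  `dolbeaultLaplacian_eq_delLaplacian_of_isManifold_complex g o`, Voisin Thm. 6.7), a THEOREM of the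
  tree on a Hausdorff complex manifold:
  `dolbeaultLaplacian_eq_delLaplacian_of_isManifold_complex_of_t2Space`
  (`KaehlerIdentityLaplacianCorollaries.lean`).

The only bookkeeping: the assembly asks for `hK` with no separation hypothesis in scope, while the
tree's theorem is stated under `[T2Space M]`; but the fact itself binds `[CompactSpace M] [T2Space M]
[IsKaehlerManifold E M]` before `p q`, so these binders are introduced first and the assembly is
applied afterwards (at `n := dim_ℝ E`), with the Hausdorff instance then available to `hK`.

* **`hodgeNumber_symm_of_isKaehlerManifold_holds`** — discharge of the named fact.
* `hodgeNumber_symm_holds g` — discharge of the metric form `hodgeNumber_symm g` of `KaehlerHodge.lean`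
  (for every smooth metric term `g`: compact Hausdorff + `g` Kähler ⇒ `h^{p,q} = h^{q,p}`), by the
  tree's `hodgeNumber_symm_of_hodgeNumber_symm_of_isKaehlerManifold`; and its binder form
  `hodgeNumber_symm_of_isKaehler g hg p q`.

No definition and no named fact is introduced (D-0026).

## References

* C. Voisin, *Hodge Theory and Complex Algebraic Geometry I* (2002), §5.3.2 Thm. 5.24, §6.1.2
  Thm. 6.7, Cor. 6.10, §6.1.3 Cor. 6.12. [Voisin2002] [VoisinHodgeI2002]
* D. Huybrechts, *Complex Geometry* (2005), Prop. 3.1.12, Cor. 3.2.12. [Huybrechts2005]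
* F. W. Warner, *Foundations of Differentiable Manifolds and Lie Groups*, GTM 94 (1983), Thms. 6.5,
  6.6. [WarnerGTM94]
* P. Griffiths, J. Harris, *Principles of Algebraic Geometry* (1978), pp. 115–116. [GriffithsHarris1978]
-/


noncomputable section

open scoped Manifold ContDiff Topology
open Bundle Module Literature.Geometry.Kaehler Literature.AlgebraicGeometry.Motives

namespace Literature.NumberTheory.Transcendental

-- The identification `TangentSpace I x = E` is an abuse of definitional equality (see
-- `NormedSpace.fromTangentSpace`); as in Mathlib's tangent-bundle files we let `isDefEq` unfold it.
set_option backward.isDefEq.respectTransparency false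

variable {E : Type*} [NormedAddCommGroup E] [NormedSpace ℂ E] [FiniteDimensional ℂ E]
  {M : Type*} [TopologicalSpace M] [ChartedSpace E M]
  [IsManifold 𝓘(ℂ, E) ω M] [IsManifold 𝓘(ℝ, E) ∞ M]

/-- **Hodge symmetry** (discharge of the named fact `hodgeNumber_symm_of_isKaehlerManifold`): on a
compact Hausdorff complex manifold admitting a smooth Kähler metric, `h^{p,q} = h^{q,p}` for all
`p q`. Voisin's proof of Cor. 6.12: `Δ_∂̄ = Δ_∂` (Thm. 6.7) gives `\overline{ℋ^{p,q}} = ℋ^{q,p}`, and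
the Hodge theorem for `∂̄` (Thm. 5.24, from Warner's Theorems 6.6 / 6.5 for `Δ_∂̄`) gives
`dim_ℂ ℋ^{p,q} = h^{p,q}`; assembled by
`hodgeNumber_symm_of_isKaehlerManifold_of_regularity_of_compactness_of_kaehlerIdentity`, all three
inputs being theorems of the tree. [cite: Voisin2002, §6.1.3 Cor. 6.12] -/
theorem hodgeNumber_symm_of_isKaehlerManifold_holds :
    hodgeNumber_symm_of_isKaehlerManifold (E := E) (M := M) := by
  intro _ _ _ p q
  haveI : Fact (finrank ℝ E = finrank ℝ E) := ⟨rfl⟩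
  refine hodgeNumber_symm_of_isKaehlerManifold_of_regularity_of_compactness_of_kaehlerIdentity
    (E := E) (M := M) (n := finrank ℝ E) ?_ ?_ ?_ p q
  · intro g o m _ _ _ _ hJ p' q' h ho
    letI : RiemannianBundle (fun x : M ↦ TangentSpace 𝓘(ℝ, E) x) := ⟨g.toRiemannianMetric⟩
    haveI : IsContMDiffRiemannianBundle 𝓘(ℝ, E) ∞ E (fun x : M ↦ TangentSpace 𝓘(ℝ, E) x) :=
      ⟨g.inner, g.contMDiff, fun _ _ _ ↦ rfl⟩
    haveI : Fact (IsSmoothForm (riemannianVolumeForm o)) := ⟨ho⟩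
    exact fun u c hb hΔ ↦ CL2SmoothForms.pq_compact o hJ p' q' h u c hb hΔ
  · intro g o m _ _ _ _ hJ p' q' h ho
    letI : RiemannianBundle (fun x : M ↦ TangentSpace 𝓘(ℝ, E) x) := ⟨g.toRiemannianMetric⟩
    haveI : IsContMDiffRiemannianBundle 𝓘(ℝ, E) ∞ E (fun x : M ↦ TangentSpace 𝓘(ℝ, E) x) :=
      ⟨g.inner, g.contMDiff, fun _ _ _ ↦ rfl⟩
    haveI : Fact (IsSmoothForm (riemannianVolumeForm o)) := ⟨ho⟩
    exact fun α ℓ hw ↦ CL2SmoothForms.pq_regular o hJ p' q' h α ℓ hw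
  · intro g o k m
    exact dolbeaultLaplacian_eq_delLaplacian_of_isManifold_complex_of_t2Space g o

variable (g : ContMDiffRiemannianMetric 𝓘(ℝ, E) ∞ E (fun x : M ↦ TangentSpace 𝓘(ℝ, E) x))

/-- **Hodge symmetry, metric form** (discharge of the named fact `hodgeNumber_symm g` of
`KaehlerHodge.lean`): for every smooth metric term `g` on the real tangent bundle of the complex
manifold `M` — if `M` is compact Hausdorff and `g` is Kähler, then `h^{p,q} = h^{q,p}`. From
`hodgeNumber_symm_of_isKaehlerManifold_holds` by the tree's
`hodgeNumber_symm_of_hodgeNumber_symm_of_isKaehlerManifold` (`⟨g, hg⟩` witnesses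
`IsKaehlerManifold E M`). [cite: Voisin2002, §6.1.3 Cor. 6.12] -/
theorem hodgeNumber_symm_holds : hodgeNumber_symm g :=
  hodgeNumber_symm_of_hodgeNumber_symm_of_isKaehlerManifold
    (hodgeNumber_symm_of_isKaehlerManifold_holds (E := E) (M := M)) g

/-- **Hodge symmetry from a Kähler metric term**, binder form: if the smooth metric `g` on the
compact Hausdorff complex manifold `M` is Kähler, then `h^{p,q} = h^{q,p}`.
[cite: Voisin2002, §6.1.3 Cor. 6.12] -/
theorem hodgeNumber_symm_of_isKaehler [CompactSpace M] [T2Space M]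
    (hg : g.toRiemannianMetric.IsKaehler) (p q : ℕ) :
    hodgeNumber E M p q = hodgeNumber E M q p :=
  hodgeNumber_symm_holds g hg p q

end Literature.NumberTheory.Transcendental

end
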